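import Literature.AnabelianGeometry.SemiGraphs.TemperedPiPresentation
import Literature.AnabelianGeometry.SemiGraphs.TemperedPiVerticialLevelData
import Literature.AnabelianGeometry.SemiGraphs.TemperedReconstructionR3cProofs
import Literature.AnabelianGeometry.SemiGraphs.TemperedVerticialDistinctSameVertex
import Literature.AnabelianGeometry.SemiGraphs.TemperedCompactInVerticialAt
import Literature.AnabelianGeometry.SemiGraphs.TemperedEdgeLikeDistinctProofs
import Literature.AnabelianGeometry.SemiGraphs.TemperedVerticialNamedFactsProofs
import Literature.AnabelianGeometry.SemiGraphs.TreeFixedPairProofs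

/-!
# [SemiAnbd] Thm 3.7 (iii)/(iv) AT `𝒢`, presentation form: an edge-like subgroup is the meet of ANY two
# distinct verticial subgroups containing it; `edge_eq_inf` for subgroup presentations with verticial /
# edge-like representatives (proof-only)

Mochizuki, *Semi-graphs of anabelioids*, Publ. RIMS **42** (2006), Thm 3.7 (iii), (iv) pp. 40–41 ("any
compact subgroup … is contained in … at most two verticial subgroups"; "the edge-like subgroups are
precisely the intersections of two distinct verticial subgroups") [cite: MochizukiSemiAnbd2006, Thm 3.7(iv) p.41].
abc-iut cell, layer L3 (GAP-LEDGER G-w4d053-1 context: the `edge_eq_inf` field of `IsArithCompatible`);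
seat abc-iut-w4-d082 gen 3.  PROOF-ONLY (no definition, no new named fact).

The tree's `edgeLikeIsInfVerticial_of` (abc-iut-L3-t11) / the At-fact `EdgeLikeIsInfVerticialAt 𝒢` write a
nontrivial edge-like subgroup `L` of a closed edge as `H₁ ⊓ H₂` for SOME pair of distinct verticial subgroups;
consumers holding their OWN two hosts `K₁ ≠ K₂ ⊇ L` (e.g. the positioned vertex groups `s_b⁻¹ H_w s_b` of a
subgroup presentation) need `K₁ ⊓ K₂ = L`.  This is immediate from the "at most two hosts" clause of
`CompactInVerticialAt 𝒢` (Thm 3.7 (iii)), which pins `{K₁, K₂} = {H₁, H₂}`: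
* `inf_eq_of_edgeLike_le_of_ne` — the chart-level statement (§3 analogue of the arithmetic
  `edgeLike_eq_inf_of_le_of_le_of_action` of `ArithEdgeLikeHosts.lean`);
* `SubgroupPresentation.map_conj_inv_s_ne_of_ne` — the two positioned vertex groups of an edge of a
  presentation with verticial representatives ARE distinct: for `w ≠ w'` by Thm 3.7 (ii)
  (`verticialDistinct_holds`), for a loop iff `s_{b'} s_b⁻¹ ∉ H_w` (self-normalisation) — the no-loop input;
* `SubgroupPresentation.hinf_of_compactInVerticialAt` — the containment half of `edge_eq_inf`
  (`s_b x s_b⁻¹ ∈ H_w → s_{b'} x s_{b'}⁻¹ ∈ H_{w'} → x ∈ M_e`) for ANY presentation over a chart with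
  verticial / edge-like representatives and `M_e ≠ ⊥` (the other half is the presentation axiom `conj_mem`,
  `SubgroupPresentation.edge_eq_inf_of_inf_le` in `ArithPiPresentationOuterCompat.lean`);
* `piPresentation_M_ne_bot` — at abc-iut-L3-d4's presentation of `𝔾` in `π₁^temp(𝒢)` the edge groups are
  nontrivial (Thm 3.7 (i) `verticialInjective_holds` + `infinite_branchSubgroup`).
For the Galois tower itself abc-iut-w4-d085's `GaloisLevelData.piPresentation_hEI` (p428788,
`TemperedPiEdgeGroupsInfVerticial.lean`) proves `edge_eq_inf` UNCONDITIONALLY from the tower of trees; the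
present file is the route through the named At-facts, usable for presentations that are not Galois towers.
Nothing here takes a side on [IUTchIII] Cor 3.12; typed ≠ proved.
-/

namespace Literature.AnabelianGeometry.SemiGraphs

open Literature.AnabelianGeometry.EtaleTheta
open CategoryTheory

universe u w

namespace ProfiniteSemiGraph

variable {𝒢 : ProfiniteSemiGraph.{u}}

/-! ### Thm 3.7 (iii) + (iv) at `𝒢`: an edge-like subgroup is the meet of ANY two distinct verticial hosts -/

/-- **A nontrivial edge-like subgroup of a closed edge is the meet of any two DISTINCT verticial subgroups
containing it** (Thm 3.7 (iv) clause 2 gives `L = H₁ ⊓ H₂`; Thm 3.7 (iii)'s "at most two hosts" pins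
`{K₁, K₂} = {H₁, H₂}`). [cite: MochizukiSemiAnbd2006, Thm 3.7(iv) p.41] -/
theorem inf_eq_of_edgeLike_le_of_ne (hCV : CompactInVerticialAt 𝒢) (hEIV : EdgeLikeIsInfVerticialAt 𝒢)
    (h37 : 𝒢.Thm37Hypotheses) (c : TemperedPiChart 𝒢) {e : 𝒢.graph.Edge} (he : 𝒢.graph.IsClosedEdge e)
    {L : Subgroup c.G} (hL : L ∈ edgeLikeSubgroups c e) (hLne : L ≠ ⊥)
    {w w' : 𝒢.graph.Vertex} {K₁ K₂ : Subgroup c.G} (hK₁ : K₁ ∈ verticialSubgroups c w)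
    (hK₂ : K₂ ∈ verticialSubgroups c w') (h₁ : L ≤ K₁) (h₂ : L ≤ K₂) (hne : K₁ ≠ K₂) :
    K₁ ⊓ K₂ = L := by
  obtain ⟨v₁, v₂, H₁, H₂, hH₁, hH₂, hH, hLH⟩ := hEIV h37 c e he L hL hLne
  obtain ⟨honly, -⟩ := (hCV h37 c L (isCompact_of_mem_edgeLikeSubgroups c hL)).2 hLne v₁ v₂ H₁ H₂ hH₁
    hH₂ hH (hLH ▸ inf_le_left) (hLH ▸ inf_le_right)
  rcases honly w K₁ hK₁ h₁ with rfl | rfl <;> rcases honly w' K₂ hK₂ h₂ with rfl | rfl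
  · exact absurd rfl hne
  · exact hLH.symm
  · rw [inf_comm]; exact hLH.symm
  · exact absurd rfl hne

/-! ### Presentations with verticial / edge-like representatives -/

section Presentation

variable (c : TemperedPiChart 𝒢) (P : SemiGraph.SubgroupPresentation 𝒢.graph c.G)

/-- Conjugation bookkeeping: `s x s⁻¹ ∈ H ↔ x ∈ s⁻¹ H s`. [cite: MochizukiSemiAnbd2006, Thm 3.7(iv) p.41] -/
theorem mem_map_conj_inv_iff {Γ : Type u} [Group Γ] (H : Subgroup Γ) (s x : Γ) :
    x ∈ H.map (MulAut.conj s⁻¹).toMonoidHom ↔ s * x * s⁻¹ ∈ H := by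
  rw [Subgroup.mem_map]
  constructor
  · rintro ⟨y, hy, rfl⟩
    simpa [MulAut.conj_apply, mul_assoc] using hy
  · intro hx
    exact ⟨s * x * s⁻¹, hx, by simp [mul_assoc]⟩

/-- **The two positioned vertex groups of an edge are distinct**: `s_b⁻¹ H_w s_b ≠ s_{b'}⁻¹ H_{w'} s_{b'}` for
the two branches `b : e → w`, `b' : e → w'` — for `w ≠ w'` by Thm 3.7 (ii) (`verticialDistinct_holds`:
verticial subgroups at distinct vertices have mutual index `0`, so are not equal), for a loop from the
no-loop input `hloop : s_{b'} s_b⁻¹ ∉ H_w` (self-normalisation of verticial subgroups).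
[cite: MochizukiSemiAnbd2006, Thm 3.7(ii) p.40] -/
theorem _root_.Literature.AnabelianGeometry.SemiGraphs.SemiGraph.SubgroupPresentation.map_conj_inv_s_ne_of_ne
    (h37 : 𝒢.Thm37Hypotheses) (hPH : ∀ w, P.H w ∈ verticialSubgroups c w)
    (hloop : ∀ (b b' : 𝒢.graph.Branch) (w : 𝒢.graph.Vertex), b ≠ b' → 𝒢.graph.edgeOf b = 𝒢.graph.edgeOf b' →
      𝒢.graph.abuts b = some w → 𝒢.graph.abuts b' = some w → P.s b' * (P.s b)⁻¹ ∉ P.H w)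
    {b b' : 𝒢.graph.Branch} {w w' : 𝒢.graph.Vertex} (hbb' : b ≠ b')
    (he : 𝒢.graph.edgeOf b = 𝒢.graph.edgeOf b') (hb : 𝒢.graph.abuts b = some w)
    (hb' : 𝒢.graph.abuts b' = some w') :
    (P.H w).map (MulAut.conj (P.s b)⁻¹).toMonoidHom ≠ (P.H w').map (MulAut.conj (P.s b')⁻¹).toMonoidHom := by
  intro hK
  by_cases hww' : w = w'
  · subst hww'
    refine hloop b b' w hbb' he hb hb' ?_
    -- `g := s_{b'} s_b⁻¹` normalises `H_w`, hence lies in it (verticial subgroups are self-normalising)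
    have key : ∀ y, y ∈ P.H w ↔
        (P.s b')⁻¹ * y * P.s b' ∈ (P.H w).map (MulAut.conj (P.s b)⁻¹).toMonoidHom := by
      intro y
      rw [hK, mem_map_conj_inv_iff]
      simp [mul_assoc]
    refine mem_of_map_conj_eq_of_mem_verticialSubgroups verticialDistinct_holds h37 c (hPH w) ?_
    ext y
    rw [Subgroup.mem_map]
    constructor
    · rintro ⟨x, hx, rfl⟩
      refine (key _).2 ?_
      rw [mem_map_conj_inv_iff]
      simpa [mul_assoc] using hx
    · intro hy
      have hy' := (key y).1 hy
      rw [mem_map_conj_inv_iff] at hy'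
      exact ⟨P.s b * ((P.s b')⁻¹ * y * P.s b') * (P.s b)⁻¹, hy', by simp [mul_assoc]⟩
  · have h0 := (verticialDistinct_holds 𝒢 h37 c).1 w w' _ _
      (conj_mem_verticialSubgroups c (hPH w) (P.s b)⁻¹)
      (conj_mem_verticialSubgroups c (hPH w') (P.s b')⁻¹) hww'
    rw [hK, Subgroup.relIndex_self] at h0
    exact one_ne_zero h0

/-- **The binder `hinf` for a presentation with verticial / edge-like representatives**: for the two distinct
branches `b : e → w`, `b' : e → w'` of an edge, `s_b x s_b⁻¹ ∈ H_w` and `s_{b'} x s_{b'}⁻¹ ∈ H_{w'}` imply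
`x ∈ M_e` — from `CompactInVerticialAt 𝒢`, `EdgeLikeIsInfVerticialAt 𝒢`, `Thm37Hypotheses`, `M_e ≠ ⊥` and the
no-loop input. [cite: MochizukiSemiAnbd2006, Thm 3.7(iv) p.41] -/
theorem _root_.Literature.AnabelianGeometry.SemiGraphs.SemiGraph.SubgroupPresentation.hinf_of_compactInVerticialAt
    (hCV : CompactInVerticialAt 𝒢) (hEIV : EdgeLikeIsInfVerticialAt 𝒢) (h37 : 𝒢.Thm37Hypotheses)
    (hPH : ∀ w, P.H w ∈ verticialSubgroups c w) (hPM : ∀ e, P.M e ∈ edgeLikeSubgroups c e)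
    (hMne : ∀ e, P.M e ≠ ⊥)
    (hloop : ∀ (b b' : 𝒢.graph.Branch) (w : 𝒢.graph.Vertex), b ≠ b' → 𝒢.graph.edgeOf b = 𝒢.graph.edgeOf b' →
      𝒢.graph.abuts b = some w → 𝒢.graph.abuts b' = some w → P.s b' * (P.s b)⁻¹ ∉ P.H w) :
    ∀ (b b' : 𝒢.graph.Branch) (w w' : 𝒢.graph.Vertex), b ≠ b' → 𝒢.graph.edgeOf b = 𝒢.graph.edgeOf b' →
      𝒢.graph.abuts b = some w → 𝒢.graph.abuts b' = some w' → ∀ x : c.G,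
        P.s b * x * (P.s b)⁻¹ ∈ P.H w → P.s b' * x * (P.s b')⁻¹ ∈ P.H w' → x ∈ P.M (𝒢.graph.edgeOf b) := by
  intro b b' w w' hbb' he hb hb' x hx hx'
  have hcl : 𝒢.graph.IsClosedEdge (𝒢.graph.edgeOf b) :=
    SemiGraph.isClosedEdge_of_abuts hbb' rfl he.symm hb hb'
  have h₁ : P.M (𝒢.graph.edgeOf b) ≤ (P.H w).map (MulAut.conj (P.s b)⁻¹).toMonoidHom := fun m hm =>
    (mem_map_conj_inv_iff (P.H w) (P.s b) m).2 (P.conj_mem b w hb m hm)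
  have h₂ : P.M (𝒢.graph.edgeOf b) ≤ (P.H w').map (MulAut.conj (P.s b')⁻¹).toMonoidHom := fun m hm =>
    (mem_map_conj_inv_iff (P.H w') (P.s b') m).2 (P.conj_mem b' w' hb' m (he ▸ hm))
  have hinf := inf_eq_of_edgeLike_le_of_ne hCV hEIV h37 c hcl (hPM _) (hMne _)
    (conj_mem_verticialSubgroups c (hPH w) (P.s b)⁻¹) (conj_mem_verticialSubgroups c (hPH w') (P.s b')⁻¹)
    h₁ h₂ (P.map_conj_inv_s_ne_of_ne c h37 hPH hloop hbb' he hb hb')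
  rw [← hinf]
  exact ⟨(mem_map_conj_inv_iff _ _ _).2 hx, (mem_map_conj_inv_iff _ _ _).2 hx'⟩

end Presentation

/-! ### At the presentation of `𝔾` in `π₁^temp(𝒢)` -/

section PiPresentation

variable (h37 : 𝒢.Thm37Hypotheses)
  (T : ∀ w : 𝒢.graph.Vertex,
    (𝒢.galoisLevelData h37.toProp36Hypotheses).PointSeq h37.toProp36Hypotheses.isCountable w)
  (R : SemiGraph.RefBranches 𝒢.graph)

/-- **The edge groups of the presentation are nontrivial**: `M_e = (T (ν e)).decompHom (Π_{β e}) ≠ 1`, since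
verticial homomorphisms are injective (Thm 3.7 (i), `verticialInjective_holds`) and `Π_{β e}` is infinite
(total elevation, `infinite_branchSubgroup`). [cite: MochizukiSemiAnbd2006, Thm 3.7(i) p.40] -/
theorem piPresentation_M_ne_bot (e : 𝒢.graph.Edge) :
    ((𝒢.galoisLevelData h37.toProp36Hypotheses).piPresentation h37.toProp36Hypotheses.isCountable T R).M e
      ≠ ⊥ := by
  rw [GaloisLevelData.piPresentation_M]
  haveI := infinite_branchSubgroup h37.toProp36Hypotheses (R.abuts_β e)
  have hinj : Function.Injective (T (R.ν e)).decompHom :=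
    ((verticialInjective_holds 𝒢 h37 (𝒢.temperedPiChart h37.toProp36Hypotheses) (R.ν e)).2
      (T (R.ν e)).decompHomCont (T (R.ν e)).isVerticialHom_decompHomCont :)
  intro h
  rw [Subgroup.map_eq_bot_iff_of_injective _ hinj] at h
  have : Finite (𝒢.branchSubgroup (R.β e) (R.ν e) (R.abuts_β e)) := by
    rw [h]; infer_instance
  exact not_finite (𝒢.branchSubgroup (R.β e) (R.ν e) (R.abuts_β e))

end PiPresentation

end ProfiniteSemiGraph

end Literature.AnabelianGeometry.SemiGraphs
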